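import Literature.NumberTheory.EllipticCurves.TowerSaturatedAnnihilatorPairProofs
import Literature.NumberTheory.EllipticCurves.ZpExtensionEisensteinDVRSettingH4RestrictedAdjointProofs
import Literature.NumberTheory.EllipticCurves.ZpExtensionEisensteinDVRSettingH4TowerPairingProofs
import Literature.NumberTheory.EllipticCurves.ZpExtensionEisensteinOrdinaryInvariantsBoundProofs
import Literature.NumberTheory.EllipticCurves.ZpExtensionEisensteinOrdinaryFilTransferProofs
import Literature.NumberTheory.EllipticCurves.ZpExtensionEisensteinOrdinaryFilSaturationProofs
import Literature.NumberTheory.EllipticCurves.TowerPresentedSubquotientCohomologyProofs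
import Literature.NumberTheory.EllipticCurves.TowerLocalH1LiftExactProofs
import Literature.NumberTheory.GaloisCohomology.Howard2004.TransportStrictProofs
import Literature.NumberTheory.GaloisRepresentations.LocalGlobalCohomologyFiniteProofs
import Literature.NumberTheory.EllipticCurves.ZpExtensionEisensteinDVRSettingH4AnnSatProofs
import Literature.NumberTheory.EllipticCurves.ZpExtensionEisensteinOrdinaryFilSaturationMultiplicativeThreeProofs
import HarnessLib

/-!
# (ANN-SAT) at a place `v ∣ 3` of MULTIPLICATIVE reduction, `Y`-side (theorems only — no definition, no named fact, no instance, no `sorry`)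

Topic `NumberTheory/EllipticCurves` (LEAD `bsd-wall-utd-p1`, crux r205 stmt-BirchSwinnertonDyer-24737 `TwinAlgMuZeroAtThree`,
line `beta-road`, stub `stub_howardOutputsOfFamily`, E2 assembly at `v ∣ 3`).  Cell x9's
`ZpExtensionEisensteinDVRSettingH4AnnSatProofs.eisensteinTower_mem_saturatedFamilies_of_forall_localCup_eq_zero` — the
(ANN-SAT) half of (Exact) for the curve's Eisenstein tower at a place `v ∋ p` — assumes GOOD reduction with an ordinary point at
`v` and `σ • v`, used only through the three local wrappers (transfer/(ONTO)/(SAT)) of the ordinary datum.  At `p = 3` these hold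
at places of MULTIPLICATIVE reduction (`ZpExtensionEisensteinOrdinaryFilSaturationMultiplicativeThreeProofs`), so the same
theorem holds there: this file (x9's statement and proof at `p = 3` with the reduction hypotheses replaced; the generic §0
lemmas `Tower.pow_smul_eq_zero_of_map_eq_zero_of_forall_invariants{,_of_le}` are imported from x9's file).  The twin `W′` of the
universal-toric-descent route has multiplicative reduction at `3 ∥ N′`.  BSD is not proved by any of this.

References: [Howard2004HeegnerKolyvagin] §1.3 H.4, Lemma 3.1.1, Def. 3.2.6; [MilneADT2006] Ch. I Cor. 2.3, Thm. 2.6;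
[MazurRubinMemoirs2004] §1.3; [SerreGaloisCohomology1997] I §2.2, §2.4; [GreenbergLNM1716] §2.
-/

set_option autoImplicit false

noncomputable section

open Function NumberField IsDedekindDomain Field CategoryTheory
open scoped NumberField ContRepresentation

namespace WeierstrassCurve

open Literature.NumberTheory.EllipticCurves Literature.NumberTheory.GaloisRepresentations
open Literature.NumberTheory.GaloisRepresentations.DiscreteGaloisModule
open Literature.NumberTheory.GaloisCohomology Literature.NumberTheory.GaloisCohomology.Howard2004
open Literature.NumberTheory.EllipticCurves.ZpExtension (EisensteinLevel)

variable {K : Type} [Field K] [NumberField K] (W : WeierstrassCurve ℚ) [W.IsElliptic]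
  (κ : ZpExtension K 3) {m : ℕ} (hm : 1 ≤ m) (cd : ConjugationDatum K)
  (D : letI := IwasawaAlgebra.isLocalRing_quotient_X_pow_add_C 3 hm
    ∀ k, DualityDatum 3 cd ((W.eisensteinTower κ hm).ρ k) (IwasawaAlgebra.EisensteinCoeff 3 m (k + 1)))

set_option maxHeartbeats 1000000 in
/-- **(ANN-SAT) at a place `v ∣ 3` of MULTIPLICATIVE reduction for the curve's Eisenstein setting, `Y`-side** (x9's
`eisensteinTower_mem_saturatedFamilies_of_forall_localCup_eq_zero` with the local data (ONTO)/(SAT)/transfer of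
`ZpExtensionEisensteinOrdinaryFilSaturationMultiplicativeThreeProofs`; otherwise verbatim).  For `T := W.eisensteinTower κ hm`, H.4 data
`D` with `he_red`, a place `v` with ordinary structure at `v` and at `σ•v` (good reduction, `p ∈ w`, an ordinary point),
restricted pairings `P_j : Fil_v T^{(j)} × Tw T^{(j)} ⧸ δ_v Fil_{σv} T^{(j)} → A_{m,j+1}(1)` with `P_j (s, [t]) = e_j (s, t)`
and right-non-degenerate cup products, and an element `g₁ ∈ Γ_{K_v}` with `κ(τ⁻¹ g₁ τ) = p^s`, `2p^s < m`: every
compatible family `ζ` of `(H¹(K_v, Tw T^{(j)}))_j` with `(ξ_j ∪ ζ_j) = 0` for all families `ξ` saturated for the strict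
ordinary cores at `v` and all `j` is saturated for the transported strict ordinary cores from `σ•v` — the hypothesis
(ANN-SAT) / the annihilator half of (Exact) of `Tower.levelCondition_mem_iff_forall_pairing_eq_zero` at `v ∣ p`.
[cite: Howard2004HeegnerKolyvagin, §1.3 H.4, Lemma 3.1.1 and Def. 3.2.6 (arXiv p. 7 L78–82, p. 15–16)]
[cite: MilneADT2006, Ch. I Cor. 2.3 and Thm. 2.6] [cite: MazurRubinMemoirs2004, §1.3] -/
theorem eisensteinTower_mem_saturatedFamilies_of_forall_localCup_eq_zero_of_hasMultiplicativeReductionAt_three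
    (he_red : letI := IwasawaAlgebra.isLocalRing_quotient_X_pow_add_C 3 hm
      ∀ k (x y : EisensteinLevel 3 m (fun j ↦ geomTorsion (W.baseChange K) (((3 : ℕ) : ℤ) ^ j)) (k + 1 + 1)),
        IwasawaAlgebra.EisensteinCoeff.reduce 3 m (Nat.le_succ (k + 1)) ((D (k + 1)).e x y) =
          (D k).e ((W.eisensteinTower κ hm).red k x) ((W.eisensteinTower κ hm).red k y))
    {v : HeightOneSpectrum (𝓞 K)} [CharZero (v.adicCompletion K)]
    (hmult : (W.baseChange K).HasMultiplicativeReductionAt v) (hpv : ((3 : ℕ) : 𝓞 K) ∈ v.asIdeal)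
    (hmultσ : (W.baseChange K).HasMultiplicativeReductionAt (cd.σ • v)) (hpσv : ((3 : ℕ) : 𝓞 K) ∈ (cd.σ • v).asIdeal)
    (P : letI := IwasawaAlgebra.isLocalRing_quotient_X_pow_add_C 3 hm
      ∀ j, ContPairing
        ((GaloisRep.toLocal v ((W.eisensteinTower κ hm).ρ j)).subrepresentation
          (((W.baseChange K).ordinaryFiltrationAt v (fun j ↦ (W.baseChange K).torsionGaloisModuleReduce 3 j)
            (fun _ _ ↦ rfl)).twistedFil (p := 3) (m := m) (j + 1))
          (((W.baseChange K).ordinaryFiltrationAt v (fun j ↦ (W.baseChange K).torsionGaloisModuleReduce 3 j)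
            (fun _ _ ↦ rfl)).twistedFil_le_comap (κ := κ) hm (j + 1))).toTopRep
        ((GaloisRep.toLocal v (cd.twist ((W.eisensteinTower κ hm).ρ j))).quotient
          ((((W.baseChange K).ordinaryFiltrationAt (cd.σ • v) (fun j ↦ (W.baseChange K).torsionGaloisModuleReduce 3 j)
            (fun _ _ ↦ rfl)).twistedFil (p := 3) (m := m) (j + 1)).map (((W.eisensteinTower κ hm).ρ j) (cd.δ v)))
          (cd.map_delta_le_comap_twist ((W.eisensteinTower κ hm).ρ j) v _ fun g ↦
            ((W.baseChange K).ordinaryFiltrationAt (cd.σ • v) (fun j ↦ (W.baseChange K).torsionGaloisModuleReduce 3 j)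
              (fun _ _ ↦ rfl)).twistedFil_le_comap (κ := κ) hm (j + 1) g)).toTopRep
        (GaloisRep.toLocal v (D j).twistOne).toTopRep)
    (hP : letI := IwasawaAlgebra.isLocalRing_quotient_X_pow_add_C 3 hm
      ∀ (j : ℕ) (s : ((W.baseChange K).ordinaryFiltrationAt v (fun j ↦ (W.baseChange K).torsionGaloisModuleReduce 3 j)
            (fun _ _ ↦ rfl)).twistedFil (p := 3) (m := m) (j + 1))
        (t : EisensteinLevel 3 m (fun j ↦ geomTorsion (W.baseChange K) (((3 : ℕ) : ℤ) ^ j)) (j + 1)),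
        (P j).toLin s (Submodule.Quotient.mk t) =
          (D j).e ((s : IwasawaAlgebra.EisensteinCoeff.Twisted 3 m (j + 1) (geomTorsion (W.baseChange K) (((3 : ℕ) : ℤ) ^ (j + 1)))) :
            EisensteinLevel 3 m (fun j ↦ geomTorsion (W.baseChange K) (((3 : ℕ) : ℤ) ^ j)) (j + 1)) t)
    (hPnd : letI := IwasawaAlgebra.isLocalRing_quotient_X_pow_add_C 3 hm
      ∀ (j : ℕ) (y : galoisCohomology ((GaloisRep.toLocal v (cd.twist ((W.eisensteinTower κ hm).ρ j))).quotient
          ((((W.baseChange K).ordinaryFiltrationAt (cd.σ • v) (fun j ↦ (W.baseChange K).torsionGaloisModuleReduce 3 j)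
            (fun _ _ ↦ rfl)).twistedFil (p := 3) (m := m) (j + 1)).map (((W.eisensteinTower κ hm).ρ j) (cd.δ v)))
          (cd.map_delta_le_comap_twist ((W.eisensteinTower κ hm).ρ j) v _ fun g ↦
            ((W.baseChange K).ordinaryFiltrationAt (cd.σ • v) (fun j ↦ (W.baseChange K).torsionGaloisModuleReduce 3 j)
              (fun _ _ ↦ rfl)).twistedFil_le_comap (κ := κ) hm (j + 1) g)) 1),
        (∀ x, (P j).cupProduct x y = 0) → y = 0)
    {g₁ : absoluteGaloisGroup (v.adicCompletion K)} {s : ℕ}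
    (hg₁ : (κ (cd.conj (absGaloisRestrict K (v.adicCompletion K) g₁))).toAdd = ((3 ^ s : ℕ) : ℤ_[3]))
    (hms : 2 * 3 ^ s < m)
    {ζ : letI := IwasawaAlgebra.isLocalRing_quotient_X_pow_add_C 3 hm
      Π j, galoisCohomology ((cd.twist ((W.eisensteinTower κ hm).ρ j)).toLocal (Sum.inr v)) 1}
    (hζ : letI := IwasawaAlgebra.isLocalRing_quotient_X_pow_add_C 3 hm
      ζ ∈ Tower.compatibleFamilies
        (H := fun j ↦ galoisCohomology ((cd.twist ((W.eisensteinTower κ hm).ρ j)).toLocal (Sum.inr v)) 1)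
        (fun j ↦ ContinuousRep.cohomologyMap ((cd.twist ((W.eisensteinTower κ hm).ρ (j + 1))).toLocal (Sum.inr v))
          ((cd.twist ((W.eisensteinTower κ hm).ρ j)).toLocal (Sum.inr v)) ((W.eisensteinTower κ hm).red j).toAddMonoidHom
          continuous_of_discreteTopology (fun _ z => (W.eisensteinTower κ hm).red_equivariant j _ z) 1))
    (h0 : letI := IwasawaAlgebra.isLocalRing_quotient_X_pow_add_C 3 hm
      ∀ (j : ℕ), ∀ ξ ∈ Tower.saturatedFamilies
        (H := fun j ↦ galoisCohomology (((W.eisensteinTower κ hm).ρ j).toLocal (Sum.inr v)) 1)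
        (fun j ↦ ContinuousRep.cohomologyMap (((W.eisensteinTower κ hm).ρ (j + 1)).toLocal (Sum.inr v))
          (((W.eisensteinTower κ hm).ρ j).toLocal (Sum.inr v)) ((W.eisensteinTower κ hm).red j).toAddMonoidHom
          continuous_of_discreteTopology (fun _ z => (W.eisensteinTower κ hm).red_equivariant j _ z) 1) 3
        (fun j ↦ ((W.baseChange K).ordinaryFiltrationAt v (fun j ↦ (W.baseChange K).torsionGaloisModuleReduce 3 j)
          (fun _ _ ↦ rfl)).ordinaryCore hm (j + 1)),
        (D j).localCup (Sum.inr v) (ξ j) (ζ j) = 0) :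
    letI := IwasawaAlgebra.isLocalRing_quotient_X_pow_add_C 3 hm
    ζ ∈ Tower.saturatedFamilies
      (H := fun j ↦ galoisCohomology ((cd.twist ((W.eisensteinTower κ hm).ρ j)).toLocal (Sum.inr v)) 1)
      (fun j ↦ ContinuousRep.cohomologyMap ((cd.twist ((W.eisensteinTower κ hm).ρ (j + 1))).toLocal (Sum.inr v))
        ((cd.twist ((W.eisensteinTower κ hm).ρ j)).toLocal (Sum.inr v)) ((W.eisensteinTower κ hm).red j).toAddMonoidHom
        continuous_of_discreteTopology (fun _ z => (W.eisensteinTower κ hm).red_equivariant j _ z) 1) 3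
      (fun j ↦ (((W.baseChange K).ordinaryFiltrationAt (cd.σ • v)
          (fun j ↦ (W.baseChange K).torsionGaloisModuleReduce 3 j) (fun _ _ ↦ rfl)).ordinaryCore hm (j + 1)).map
        (cd.transportH1 (κ.eisensteinTwist ((W.baseChange K).torsionGaloisModule (((3 : ℕ) : ℤ) ^ (j + 1))) hm (j + 1)) v)) := by
  letI := IwasawaAlgebra.isLocalRing_quotient_X_pow_add_C 3 hm
  have hpp := Nat.prime_three
  have hpK : (3 : K) ≠ 0 := by exact_mod_cast hpp.ne_zero
  -- finiteness of the levels
  haveI hfinM : ∀ j, Finite (EisensteinLevel 3 m (fun j ↦ geomTorsion (W.baseChange K) (((3 : ℕ) : ℤ) ^ j)) j) := fun j ↦ by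
    haveI : Finite (geomTorsion (W.baseChange K) (((3 : ℕ) : ℤ) ^ j)) :=
      finite_torsionPoints_holds (W.baseChange K) (AlgebraicClosure K) (n := ((3 : ℕ) : ℤ) ^ j)
        (pow_ne_zero _ (by exact_mod_cast hpp.ne_zero))
    exact IwasawaAlgebra.EisensteinCoeff.finite_twisted (p := 3) (k := j)
      (M := geomTorsion (W.baseChange K) (((3 : ℕ) : ℤ) ^ j)) hm
  /- ### A. the plain local presented family at `v` (levels `a ≥ 0`, `W_a = E_K[p^a] ⊗ A_{m,a}(ψ)`) -/
  let Fam : ∀ a b, (κ.eisensteinTwist ((W.baseChange K).torsionGaloisModule (((3 : ℕ) : ℤ) ^ a)) hm a).toContRepresentation →ⁱL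
      (κ.eisensteinTwist ((W.baseChange K).torsionGaloisModule (((3 : ℕ) : ℤ) ^ b)) hm b).toContRepresentation :=
    fun a b ↦ (W.baseChange K).eisensteinTwistTorsionTransfer κ hm
      (fun j ↦ (W.baseChange K).torsionGaloisModuleReduce 3 j) (W.torsionGaloisModuleReduce_coe (K := K) (p := 3)) a b
  let ρloc : ∀ a, DiscreteGaloisModule (v.adicCompletion K)
      (EisensteinLevel 3 m (fun j ↦ geomTorsion (W.baseChange K) (((3 : ℕ) : ℤ) ^ j)) a) :=
    fun a ↦ (κ.eisensteinTwist ((W.baseChange K).torsionGaloisModule (((3 : ℕ) : ℤ) ^ a)) hm a).toLocal (Sum.inr v)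
  let floc : ∀ a b, (ρloc a).toContRepresentation →ⁱL (ρloc b).toContRepresentation :=
    fun a b ↦ Literature.NumberTheory.EllipticCurves.DiscreteGaloisModule.localMap (Fam a b) (Sum.inr v)
  have hid : ∀ a (x : EisensteinLevel 3 m (fun j ↦ geomTorsion (W.baseChange K) (((3 : ℕ) : ℤ) ^ j)) a), floc a a x = x :=
    fun a x ↦ κ.eisensteinTwistTransfer_self (fun k ↦ (W.baseChange K).torsionGaloisModule (((3 : ℕ) : ℤ) ^ k))
      (fun j ↦ (W.baseChange K).torsionGaloisModuleReduce 3 j) hm _ _ _ a x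
  have hcomp : ∀ a b c', c' ≤ b → b ≤ a →
      ∀ x : EisensteinLevel 3 m (fun j ↦ geomTorsion (W.baseChange K) (((3 : ℕ) : ℤ) ^ j)) a, floc b c' (floc a b x) = floc a c' x :=
    fun a b c' hcb hba x ↦ κ.eisensteinTwistTransfer_comp (fun k ↦ (W.baseChange K).torsionGaloisModule (((3 : ℕ) : ℤ) ^ k))
      (fun j ↦ (W.baseChange K).torsionGaloisModuleReduce 3 j) hm _ _ _ hcb hba x
  have hsurj : ∀ ℓ n, Function.Surjective (floc (ℓ + n) n) :=
    fun ℓ n ↦ κ.eisensteinTwistTransfer_surjective_of_le (fun k ↦ (W.baseChange K).torsionGaloisModule (((3 : ℕ) : ℤ) ^ k))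
      (fun j ↦ (W.baseChange K).torsionGaloisModuleReduce 3 j) hm _ _ _ (Nat.le_add_left n ℓ)
  have hex : ∀ ℓ n (y : EisensteinLevel 3 m (fun j ↦ geomTorsion (W.baseChange K) (((3 : ℕ) : ℤ) ^ j)) (ℓ + n)),
      floc (ℓ + n) n y = 0 ↔ ∃ x, floc ℓ (ℓ + n) x = y :=
    fun ℓ n y ↦ κ.eisensteinTwistTransfer_eq_zero_iff_exists (fun k ↦ (W.baseChange K).torsionGaloisModule (((3 : ℕ) : ℤ) ^ k))
      (fun j ↦ (W.baseChange K).torsionGaloisModuleReduce 3 j) hm _ _ _ ℓ n y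
  /- ### B. the sub-tower `Fil_v W_a` at `v` and its `H¹` (the `F`-tower) -/
  let Fil : ∀ a, Submodule ℤ (EisensteinLevel 3 m (fun j ↦ geomTorsion (W.baseChange K) (((3 : ℕ) : ℤ) ^ j)) a) := fun a ↦
    ((W.baseChange K).ordinaryFiltrationAt v (fun j ↦ (W.baseChange K).torsionGaloisModuleReduce 3 j)
      (fun _ _ ↦ rfl)).twistedFil (p := 3) (m := m) a
  have hΓ : ∀ a (σ : absoluteGaloisGroup (v.adicCompletion K)), Fil a ≤ (Fil a).comap (ρloc a σ) := fun a σ ↦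
    ((W.baseChange K).ordinaryFiltrationAt v (fun j ↦ (W.baseChange K).torsionGaloisModuleReduce 3 j)
      (fun _ _ ↦ rfl)).twistedFil_le_comap (κ := κ) hm a σ
  have hmapv : ∀ a b, ∀ w ∈ Fil a, floc a b w ∈ Fil b := fun a b w hw ↦
    (W.baseChange K).eisensteinTwistTransfer_mem_twistedFil_ordinaryFiltrationAt_of_hasMultiplicativeReductionAt_three v κ hm
      (fun j ↦ (W.baseChange K).torsionGaloisModuleReduce 3 j) (fun _ _ ↦ rfl) hpv hmult a b w hw
  obtain ⟨g, hg⟩ := Tower.exists_subFamily_apply_eq ρloc floc Fil hΓ hmapv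
  -- the `F`-tower (D-indexed: level `j ↦ Fil_v W_{j+1}`), its reductions and the inclusions `ι_j = H¹(subtype)`
  let ρF : ∀ j, DiscreteGaloisModule (v.adicCompletion K) (Fil (j + 1)) :=
    fun j ↦ (ρloc (j + 1)).subrepresentation (Fil (j + 1)) (hΓ (j + 1))
  haveI hfinF : ∀ j, Finite (galoisCohomology (ρF j) 1) := fun j ↦
    finite_galoisCohomology_one_adicCompletion v (ρF j)
  let redF : ∀ j, galoisCohomology (ρF (j + 1)) 1 →+ galoisCohomology (ρF j) 1 :=
    fun j ↦ galoisCohomology.map (g (j + 1 + 1) (j + 1)) 1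
  let ι : ∀ j, galoisCohomology (ρF j) 1 →+ galoisCohomology (((W.eisensteinTower κ hm).ρ j).toLocal (Sum.inr v)) 1 :=
    fun j ↦ (cohomologyMap (subtypeHom (ρloc (j + 1)) (Fil (j + 1)) (hΓ (j + 1))) 1).hom.toLinearMap.toAddMonoidHom
  have hιdef : ∀ j (f : galoisCohomology (ρF j) 1),
      ι j f = cohomologyMap (subtypeHom (ρloc (j + 1)) (Fil (j + 1)) (hΓ (j + 1))) 1 f := fun j f ↦ rfl
  -- the reductions of the `D`-indexed tower are `H¹(floc (j+2) (j+1))`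
  have hred : ∀ (j : ℕ) (x : galoisCohomology (((W.eisensteinTower κ hm).ρ (j + 1)).toLocal (Sum.inr v)) 1),
      ContinuousRep.cohomologyMap (((W.eisensteinTower κ hm).ρ (j + 1)).toLocal (Sum.inr v))
          (((W.eisensteinTower κ hm).ρ j).toLocal (Sum.inr v)) ((W.eisensteinTower κ hm).red j).toAddMonoidHom
          continuous_of_discreteTopology (fun _ z => (W.eisensteinTower κ hm).red_equivariant j _ z) 1 x =
        galoisCohomology.map (floc (j + 1 + 1) (j + 1)) 1 x := by
    intro j x
    have e1 : floc (j + 1 + 1) (j + 1) = Literature.NumberTheory.EllipticCurves.DiscreteGaloisModule.localMap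
        (κ.eisensteinTwistReduce hm (Nat.le_succ (j + 1)) ((W.baseChange K).torsionGaloisModuleReduce 3 (j + 1)))
        (Sum.inr v) := by
      change Literature.NumberTheory.EllipticCurves.DiscreteGaloisModule.localMap (κ.eisensteinTwistTransfer
        (fun k ↦ (W.baseChange K).torsionGaloisModule (((3 : ℕ) : ℤ) ^ k))
        (fun j ↦ (W.baseChange K).torsionGaloisModuleReduce 3 j) hm _ _ _ (j + 1 + 1) (j + 1)) (Sum.inr v) = _
      rw [κ.eisensteinTwistTransfer_succ_self]
    rw [e1]
    rfl
  have hι : ∀ (j : ℕ) (f : galoisCohomology (ρF (j + 1)) 1),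
      ContinuousRep.cohomologyMap (((W.eisensteinTower κ hm).ρ (j + 1)).toLocal (Sum.inr v))
          (((W.eisensteinTower κ hm).ρ j).toLocal (Sum.inr v)) ((W.eisensteinTower κ hm).red j).toAddMonoidHom
          continuous_of_discreteTopology (fun _ z => (W.eisensteinTower κ hm).red_equivariant j _ z) 1 (ι (j + 1) f) =
        ι j (redF j f) := by
    intro j f
    rw [hred, hιdef, hιdef]
    exact Tower.map_subtypeHom_eq_subtypeHom_map (ρ := ρloc) (f := floc) (Fil := Fil) (hΓ := hΓ) hg
      (j + 1 + 1) (j + 1) f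
  have hC : ∀ (j : ℕ) (f : galoisCohomology (ρF j) 1),
      ι j f ∈ ((W.baseChange K).ordinaryFiltrationAt v (fun j ↦ (W.baseChange K).torsionGaloisModuleReduce 3 j)
        (fun _ _ ↦ rfl)).ordinaryCore hm (j + 1) := fun j f ↦
    (Tower.mem_strictSubgroup_iff_exists_map_subtypeHom_eq (ρ := ρloc) (Fil := Fil) (hΓ := hΓ) (j + 1) _).2 ⟨f, rfl⟩
  /- ### C. the twisted quotient tower `Tw W_a ⧸ δ_v·Fil_{σv} W_a` at `v` (the `G`-tower) and (Ker-tors) -/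
  let Filσ : ∀ a, Submodule ℤ (EisensteinLevel 3 m (fun j ↦ geomTorsion (W.baseChange K) (((3 : ℕ) : ℤ) ^ j)) a) := fun a ↦
    ((W.baseChange K).ordinaryFiltrationAt (cd.σ • v) (fun j ↦ (W.baseChange K).torsionGaloisModuleReduce 3 j)
      (fun _ _ ↦ rfl)).twistedFil (p := 3) (m := m) a
  let Fil' : ∀ a, Submodule ℤ (EisensteinLevel 3 m (fun j ↦ geomTorsion (W.baseChange K) (((3 : ℕ) : ℤ) ^ j)) a) := fun a ↦
    (Filσ a).map ((κ.eisensteinTwist ((W.baseChange K).torsionGaloisModule (((3 : ℕ) : ℤ) ^ a)) hm a) (cd.δ v))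
  let ρ'loc : ∀ a, DiscreteGaloisModule (v.adicCompletion K)
      (EisensteinLevel 3 m (fun j ↦ geomTorsion (W.baseChange K) (((3 : ℕ) : ℤ) ^ j)) a) :=
    fun a ↦ (cd.twist (κ.eisensteinTwist ((W.baseChange K).torsionGaloisModule (((3 : ℕ) : ℤ) ^ a)) hm a)).toLocal (Sum.inr v)
  have hΓ' : ∀ a (σ : absoluteGaloisGroup (v.adicCompletion K)), Fil' a ≤ (Fil' a).comap (ρ'loc a σ) := fun a σ ↦
    cd.map_delta_le_comap_twist (κ.eisensteinTwist ((W.baseChange K).torsionGaloisModule (((3 : ℕ) : ℤ) ^ a)) hm a) v (Filσ a)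
      (fun g ↦ ((W.baseChange K).ordinaryFiltrationAt (cd.σ • v) (fun j ↦ (W.baseChange K).torsionGaloisModuleReduce 3 j)
        (fun _ _ ↦ rfl)).twistedFil_le_comap (κ := κ) hm a g) σ
  let f'loc : ∀ a b, (ρ'loc a).toContRepresentation →ⁱL (ρ'loc b).toContRepresentation :=
    fun a b ↦ Literature.NumberTheory.EllipticCurves.DiscreteGaloisModule.localMap
      (Literature.NumberTheory.EllipticCurves.DiscreteGaloisModule.restrictMap (Fam a b) cd.conj) (Sum.inr v)
  have hf'loc : ∀ a b (x : EisensteinLevel 3 m (fun j ↦ geomTorsion (W.baseChange K) (((3 : ℕ) : ℤ) ^ j)) a),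
      f'loc a b x = Fam a b x := fun a b x ↦ rfl
  -- the translate by `δ_v` commutes with the family (equivariance for the global element `δ_v`)
  have hδFam : ∀ a b (x : EisensteinLevel 3 m (fun j ↦ geomTorsion (W.baseChange K) (((3 : ℕ) : ℤ) ^ j)) a),
      Fam a b ((κ.eisensteinTwist ((W.baseChange K).torsionGaloisModule (((3 : ℕ) : ℤ) ^ a)) hm a) (cd.δ v) x) =
        (κ.eisensteinTwist ((W.baseChange K).torsionGaloisModule (((3 : ℕ) : ℤ) ^ b)) hm b) (cd.δ v) (Fam a b x) :=
    fun a b x ↦ (Fam a b).isIntertwining (cd.δ v) x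
  -- (hmapσ)/(ONTO)/(SAT) at `σ•v` for the plain family
  have hmapσ : ∀ a b, ∀ w ∈ Filσ a, Fam a b w ∈ Filσ b := fun a b w hw ↦
    (W.baseChange K).eisensteinTwistTransfer_mem_twistedFil_ordinaryFiltrationAt_of_hasMultiplicativeReductionAt_three
      (cd.σ • v) κ hm (fun j ↦ (W.baseChange K).torsionGaloisModuleReduce 3 j) (fun _ _ ↦ rfl) hpσv hmultσ a b w hw
  have hontoσ : ∀ ℓ n, ∀ w' ∈ Filσ n, ∃ w ∈ Filσ (ℓ + n), Fam (ℓ + n) n w = w' := fun ℓ n w' hw' ↦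
    (W.baseChange K).exists_mem_twistedFil_transfer_eq_ordinaryFiltrationAt_of_hasMultiplicativeReductionAt_three (cd.σ • v)
      κ hm (fun j ↦ (W.baseChange K).torsionGaloisModuleReduce 3 j) (fun _ _ ↦ rfl) hpσv hmultσ ℓ n w' hw'
  have hsatσ : ∀ ℓ n (w : EisensteinLevel 3 m (fun j ↦ geomTorsion (W.baseChange K) (((3 : ℕ) : ℤ) ^ j)) ℓ),
      Fam ℓ (ℓ + n) w ∈ Filσ (ℓ + n) → w ∈ Filσ ℓ := fun ℓ n w hw ↦
    (W.baseChange K).mem_twistedFil_of_transfer_mem_ordinaryFiltrationAt_of_hasMultiplicativeReductionAt_three (cd.σ • v)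
      κ hm (fun j ↦ (W.baseChange K).torsionGaloisModuleReduce 3 j) (fun _ _ ↦ rfl) hpσv hmultσ ℓ n w hw
  -- the same for the translates `Fil'` and the twisted family `f'loc`
  have hmap' : ∀ a b, ∀ w ∈ Fil' a, f'loc a b w ∈ Fil' b := by
    rintro a b _ ⟨x, hx, rfl⟩
    exact ⟨Fam a b x, hmapσ a b x hx, (hδFam a b x).symm⟩
  have honto' : ∀ ℓ n, ∀ w' ∈ Fil' n, ∃ w ∈ Fil' (ℓ + n), f'loc (ℓ + n) n w = w' := by
    rintro ℓ n _ ⟨x, hx, rfl⟩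
    obtain ⟨w, hw, hwx⟩ := hontoσ ℓ n x hx
    exact ⟨_, ⟨w, hw, rfl⟩, (hδFam (ℓ + n) n w).trans (congrArg _ hwx)⟩
  have hδinj : ∀ a, Function.Injective
      ((κ.eisensteinTwist ((W.baseChange K).torsionGaloisModule (((3 : ℕ) : ℤ) ^ a)) hm a) (cd.δ v)) := fun a x y hxy ↦ by
    have h := congrArg ((κ.eisensteinTwist ((W.baseChange K).torsionGaloisModule (((3 : ℕ) : ℤ) ^ a)) hm a) (cd.δ v)⁻¹) hxy
    rwa [← Module.End.mul_apply, ← Module.End.mul_apply, ← map_mul, inv_mul_cancel, map_one,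
      Module.End.one_apply, Module.End.one_apply] at h
  have hδsurj : ∀ a, Function.Surjective
      ((κ.eisensteinTwist ((W.baseChange K).torsionGaloisModule (((3 : ℕ) : ℤ) ^ a)) hm a) (cd.δ v)) := fun a y ↦
    ⟨(κ.eisensteinTwist ((W.baseChange K).torsionGaloisModule (((3 : ℕ) : ℤ) ^ a)) hm a) (cd.δ v)⁻¹ y, by
      rw [← Module.End.mul_apply, ← map_mul, mul_inv_cancel, map_one, Module.End.one_apply]⟩
  have hsat' : ∀ ℓ n (w : EisensteinLevel 3 m (fun j ↦ geomTorsion (W.baseChange K) (((3 : ℕ) : ℤ) ^ j)) ℓ),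
      f'loc ℓ (ℓ + n) w ∈ Fil' (ℓ + n) → w ∈ Fil' ℓ := by
    intro ℓ n w hw
    obtain ⟨w₀, rfl⟩ := hδsurj ℓ w
    rw [hf'loc, hδFam] at hw
    obtain ⟨y, hy, hyw⟩ := hw
    have hy' : Fam ℓ (ℓ + n) w₀ ∈ Filσ (ℓ + n) := by rw [← hδinj _ hyw]; exact hy
    exact ⟨w₀, hsatσ ℓ n w₀ hy', rfl⟩
  have hfloc : ∀ a b (x : EisensteinLevel 3 m (fun j ↦ geomTorsion (W.baseChange K) (((3 : ℕ) : ℤ) ^ j)) a),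
      floc a b x = Fam a b x := fun a b x ↦ rfl
  have hsurj' : ∀ ℓ n, Function.Surjective (f'loc (ℓ + n) n) := by
    intro ℓ n y
    obtain ⟨x, hx⟩ := hsurj ℓ n y
    refine ⟨x, ?_⟩
    rw [hf'loc, ← hfloc]
    exact hx
  have hex' : ∀ ℓ n (y : EisensteinLevel 3 m (fun j ↦ geomTorsion (W.baseChange K) (((3 : ℕ) : ℤ) ^ j)) (ℓ + n)),
      f'loc (ℓ + n) n y = 0 ↔ ∃ x, f'loc ℓ (ℓ + n) x = y := by
    intro ℓ n y
    simp only [hf'loc, ← hfloc]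
    exact hex ℓ n y
  obtain ⟨q', hq'⟩ := Tower.exists_quotFamily_apply_mk ρ'loc f'loc Fil' hΓ' hmap'
  have hinjQ : ∀ ℓ n, Function.Injective (q' ℓ (ℓ + n)) := fun ℓ n ↦ Tower.quotFamily_injective hq' hsat' ℓ n
  have hsurjQ : ∀ ℓ n, Function.Surjective (q' (ℓ + n) n) := fun ℓ n ↦ Tower.quotFamily_surjective hq' hsurj' ℓ n
  have hexQ : ∀ ℓ n (y : EisensteinLevel 3 m (fun j ↦ geomTorsion (W.baseChange K) (((3 : ℕ) : ℤ) ^ j)) (ℓ + n) ⧸ Fil' (ℓ + n)),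
      q' (ℓ + n) n y = 0 ↔ ∃ x, q' ℓ (ℓ + n) x = y := fun ℓ n y ↦ Tower.quotFamily_exact hq' hmap' hex' honto' ℓ n y
  -- the `G`-tower and (Ker-tors): `p` kills the invariants of every `Tw W_d ⧸ Fil'_d`, hence the kernels of the up-maps
  let ρG : ∀ a, DiscreteGaloisModule (v.adicCompletion K)
      (EisensteinLevel 3 m (fun j ↦ geomTorsion (W.baseChange K) (((3 : ℕ) : ℤ) ^ j)) a ⧸ Fil' a) :=
    fun a ↦ (ρ'loc a).quotient (Fil' a) (hΓ' a)
  have hcG : ∀ (d : ℕ) (u : EisensteinLevel 3 m (fun j ↦ geomTorsion (W.baseChange K) (((3 : ℕ) : ℤ) ^ j)) d ⧸ Fil' d),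
      (∀ g : absoluteGaloisGroup (v.adicCompletion K), ρG d g u = u) → 3 ^ 1 • u = 0 := by
    intro d u hu
    obtain ⟨x, rfl⟩ := Submodule.Quotient.mk_surjective (Fil' d) u
    have hx : ρ'loc d g₁ x - x ∈ Fil' d := by
      rw [← Submodule.Quotient.eq]
      exact hu g₁
    have hNA : ∀ (c : IwasawaAlgebra.EisensteinCoeff 3 m d)
        (y : EisensteinLevel 3 m (fun j ↦ geomTorsion (W.baseChange K) (((3 : ℕ) : ℤ) ^ j)) d), y ∈ Fil' d → c • y ∈ Fil' d := by
      rintro c _ ⟨y, hy, rfl⟩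
      refine ⟨c • y, ((W.baseChange K).ordinaryFiltrationAt (cd.σ • v)
        (fun j ↦ (W.baseChange K).torsionGaloisModuleReduce 3 j) (fun _ _ ↦ rfl)).smul_mem_twistedFil
          (p := 3) (m := m) d c hy, ?_⟩
      exact κ.isScalarLinear_eisensteinTwist ((W.baseChange K).torsionGaloisModule (((3 : ℕ) : ℤ) ^ d)) hm d (cd.δ v) c y
    have hNg : ∀ y ∈ (Fil' d).toAddSubgroup,
        (GaloisRep.toLocal v (cd.twist (κ.eisensteinTwist ((W.baseChange K).torsionGaloisModule (((3 : ℕ) : ℤ) ^ d)) hm d)))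
          g₁ y ∈ (Fil' d).toAddSubgroup := fun y hy ↦ hΓ' d g₁ hy
    have hpx := κ.natCast_smul_mem_of_twist_toLocal_apply_sub_mem (W.baseChange K) hm cd v hg₁ hms d
      (Fil' d).toAddSubgroup (fun c y hy ↦ hNA c y hy) hNg x hx
    have h2 : (Fil' d).mkQ (((3 : ℕ) : ℤ) • x) = 0 := (Submodule.Quotient.mk_eq_zero _).2 hpx
    rw [map_zsmul] at h2
    rw [pow_one, ← natCast_zsmul]
    exact h2
  have hKerT' : ∀ {a b : ℕ} (_ : a ≤ b) (x : galoisCohomology (ρG a) 1), galoisCohomology.map (q' a b) 1 x = 0 →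
      3 ^ 1 • x = 0 := fun hab x hx ↦
    Tower.pow_smul_eq_zero_of_map_eq_zero_of_forall_invariants_of_le ρG q' hinjQ hsurjQ hexQ 3 hcG hab x hx
  /- ### D. the `G`-tower (D-indexed), the projections `π′_j = H¹(mkQ)`, the up-maps `H¹(q′)` and (ker) -/
  let π' : ∀ j, galoisCohomology ((cd.twist ((W.eisensteinTower κ hm).ρ j)).toLocal (Sum.inr v)) 1 →+
      galoisCohomology (ρG (j + 1)) 1 :=
    fun j ↦ (ρ'loc (j + 1)).quotientMap (Fil' (j + 1)) (hΓ' (j + 1)) 1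
  let upG : ∀ k d : ℕ, galoisCohomology (ρG k.succ) 1 →+ galoisCohomology (ρG (k + d).succ) 1 :=
    fun k d ↦ galoisCohomology.map (q' (k + 1) (k + d + 1)) 1
  have hKerT : ∀ (k d : ℕ) (x : galoisCohomology (ρG (k + 1)) 1), upG k d x = 0 → 3 ^ 1 • x = 0 :=
    fun k d x hx ↦ hKerT' (show k + 1 ≤ k + d + 1 by omega) x hx
  have hC' : ∀ (j : ℕ) (y : galoisCohomology ((cd.twist ((W.eisensteinTower κ hm).ρ j)).toLocal (Sum.inr v)) 1),
      π' j y = 0 → y ∈ (((W.baseChange K).ordinaryFiltrationAt (cd.σ • v)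
          (fun j ↦ (W.baseChange K).torsionGaloisModuleReduce 3 j) (fun _ _ ↦ rfl)).ordinaryCore hm (j + 1)).map
        (cd.transportH1 (κ.eisensteinTwist ((W.baseChange K).torsionGaloisModule (((3 : ℕ) : ℤ) ^ (j + 1))) hm (j + 1)) v) := by
    intro j y hy
    have h2 : y ∈ DiscreteGaloisModule.strictSubgroup
        (GaloisRep.toLocal v (cd.twist (κ.eisensteinTwist ((W.baseChange K).torsionGaloisModule (((3 : ℕ) : ℤ) ^ (j + 1)))
          hm (j + 1)))) (Fil' (j + 1)) (hΓ' (j + 1)) := hy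
    exact (cd.map_transportH1_strictSubgroup_eq (κ.eisensteinTwist ((W.baseChange K).torsionGaloisModule
      (((3 : ℕ) : ℤ) ^ (j + 1))) hm (j + 1)) v (Filσ (j + 1))
      (fun g ↦ ((W.baseChange K).ordinaryFiltrationAt (cd.σ • v) (fun j ↦ (W.baseChange K).torsionGaloisModuleReduce 3 j)
        (fun _ _ ↦ rfl)).twistedFil_le_comap (κ := κ) hm (j + 1) g) (hΓ' (j + 1))).ge h2
  /- ### E. the restricted pairings as bi-additive maps, (proj), (Adj′), (Nondeg′) -/
  let Pa : ∀ j, galoisCohomology (ρF j) 1 →+ galoisCohomology (ρG (j + 1)) 1 →+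
      galoisCohomology ((D j).twistOne.toLocal (Sum.inr v)) 2 := fun j ↦
    { toFun := fun x ↦ ((P j).cupProduct x).toAddMonoidHom
      map_zero' := AddMonoidHom.ext fun y ↦ DFunLike.congr_fun (map_zero (P j).cupProduct) y
      map_add' := fun x x' ↦ AddMonoidHom.ext fun y ↦ DFunLike.congr_fun (map_add (P j).cupProduct x x') y }
  have hPa : ∀ j (x : galoisCohomology (ρF j) 1) (y : galoisCohomology (ρG (j + 1)) 1),
      Pa j x y = (P j).cupProduct x y := fun j x y ↦ rfl
  have hproj : ∀ (j : ℕ) (f : galoisCohomology (ρF j) 1)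
      (y : galoisCohomology ((cd.twist ((W.eisensteinTower κ hm).ρ j)).toLocal (Sum.inr v)) 1),
      (D j).localCup (Sum.inr v) (ι j f) y = Pa j f (π' j y) := by
    intro j f y
    have h := ContPairing.cupProduct_adjoint (P j) ((D j).ePairingLocal (Sum.inr v))
      (subtypeHom (ρloc (j + 1)) (Fil (j + 1)) (hΓ (j + 1))) ((ρ'loc (j + 1)).mkQHom (Fil' (j + 1)) (hΓ' (j + 1)))
      (fun x t ↦ (hP j x t).symm) f y
    exact h
  -- value maps `ι_d : A_{m,k+1} → A_{m,k+d+1}` and `incQ := H²(ι_d(1))`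
  have hιv := fun k ↦ IwasawaAlgebra.EisensteinCoeff.exists_forall_addMonoidHom_apply_reduce_eq_pow_smul (p := 3) m k
  choose ιv hιv using hιv
  let incQ : ∀ k d : ℕ, galoisCohomology ((D k).twistOne.toLocal (Sum.inr v)) 2 →+
      galoisCohomology ((D (k + d)).twistOne.toLocal (Sum.inr v)) 2 := fun k d ↦
    ContinuousRep.cohomologyMap (GaloisRep.toLocal v (D k).twistOne) (GaloisRep.toLocal v (D (k + d)).twistOne) (ιv k d)
      continuous_of_discreteTopology
      (fun _ z => (D k).twistOne_apply_of_apply_reduce (D (k + d)) _ (ιv k d) (3 ^ d) (hιv k d) _ z) 2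
  -- the sub-tower's iterated reductions are `H¹(g (k+d+1) (k+1))`
  have hidF : ∀ a (x : Fil (a + 1)), g (a + 1) (a + 1) x = x := fun a x ↦ Tower.subFamily_id hg hid (a + 1) x
  have hcompF : ∀ a b c', c' ≤ b → b ≤ a → ∀ x : Fil (a + 1), g (b + 1) (c' + 1) (g (a + 1) (b + 1) x) = g (a + 1) (c' + 1) x :=
    fun a b c' hcb hba x ↦ Tower.subFamily_comp hg hcomp (a + 1) (b + 1) (c' + 1) (by omega) (by omega) x
  have hredIter : ∀ (k d : ℕ) (w : galoisCohomology (ρF (k + d)) 1),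
      Tower.redIter (H := fun j ↦ galoisCohomology (ρF j) 1) redF k d w = galoisCohomology.map (g (k + d + 1) (k + 1)) 1 w :=
    fun k d w ↦ Tower.redIter_eq_map (ρ := fun j ↦ ρF j) (f := fun a b ↦ g (a + 1) (b + 1)) hidF hcompF k d w
  have hAdj : ∀ (k d : ℕ) (w : galoisCohomology (ρF (k + d)) 1) (y : galoisCohomology (ρG (k + 1)) 1),
      incQ k d (Pa k (Tower.redIter (H := fun j ↦ galoisCohomology (ρF j) 1) redF k d w) y) = Pa (k + d) w (upG k d y) := by
    intro k d w y
    rw [hredIter, hPa, hPa]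
    exact W.eisensteinTower_restrictedPairing_cupProduct_adjoint κ hm cd D he_red v k d (ιv k d) (hιv k d)
      (P k) (hP k) (P (k + d)) (hP (k + d)) (g (k + d + 1) (k + 1))
      (fun s' ↦ (hg _ _ s').trans (W.eisensteinTower_redIter_eq_eisensteinTwistTorsionTransfer κ hm k d _).symm)
      (q' (k + 1) (k + d + 1)) (fun t' ↦ hq' _ _ t') w y
  have hNondeg : ∀ (k d : ℕ) (y : galoisCohomology (ρG (k + d + 1)) 1),
      (∀ w : galoisCohomology (ρF (k + d)) 1, Pa (k + d) w y = 0) → y = 0 :=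
    fun k d y hy ↦ hPnd (k + d) y fun x ↦ hy x
  /- ### F. assembly -/
  exact Tower.mem_saturatedFamilies_of_forall_saturated_pairing_eq_zero_of_ker_torsion
    (X := fun j ↦ galoisCohomology (((W.eisensteinTower κ hm).ρ j).toLocal (Sum.inr v)) 1)
    (Y := fun j ↦ galoisCohomology ((cd.twist ((W.eisensteinTower κ hm).ρ j)).toLocal (Sum.inr v)) 1)
    (Q := fun j ↦ galoisCohomology ((D j).twistOne.toLocal (Sum.inr v)) 2)
    (F := fun j ↦ galoisCohomology (ρF j) 1) (G := fun j ↦ galoisCohomology (ρG (j + 1)) 1)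
    (fun j ↦ ContinuousRep.cohomologyMap (((W.eisensteinTower κ hm).ρ (j + 1)).toLocal (Sum.inr v))
      (((W.eisensteinTower κ hm).ρ j).toLocal (Sum.inr v)) ((W.eisensteinTower κ hm).red j).toAddMonoidHom
      continuous_of_discreteTopology (fun _ z => (W.eisensteinTower κ hm).red_equivariant j _ z) 1)
    (fun j ↦ (D j).localCup (Sum.inr v))
    (fun j ↦ ContinuousRep.cohomologyMap ((cd.twist ((W.eisensteinTower κ hm).ρ (j + 1))).toLocal (Sum.inr v))
      ((cd.twist ((W.eisensteinTower κ hm).ρ j)).toLocal (Sum.inr v)) ((W.eisensteinTower κ hm).red j).toAddMonoidHom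
      continuous_of_discreteTopology (fun _ z => (W.eisensteinTower κ hm).red_equivariant j _ z) 1)
    redF Pa ι π' 3 _ _ hι hC hproj hC' upG incQ hAdj hNondeg hKerT hζ h0

end WeierstrassCurve

end
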